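import Summits.Langlands.Langlands.Theorems.IrreducibilityBySelfDualityPairLBoundaryJSCornerUnitBoxLocalValue

/-!
# Crux `PairLBoundaryJS` (stmt-Langlands-13622), line `Sketch` — stub `stub_corner_unitBox_productForm` (W-CPF),
# part 2: the corner support theorem at one place, and peeling the bad places off the corner pair

Summit `Langlands`, sub-problem `Langlands`, helper file under `Theorems/` supporting the crux
`PairLBoundaryJS` (Arthur–Clozel (1989), Ch. 3, (2.2)), line `Sketch`, registered stub
`stub_corner_unitBox_productForm` (proved in `…PairLBoundaryJSCornerUnitBoxProductForm`, which imports this file;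
part 1 is `…CornerUnitBoxLocalValue`); this file proves the registered sub-goal `stub_corner_unitBox_support`.

Bookkeeping for the bad-place step of the Rankin–Selberg method for the CORNER pair `GL_{m+1} × GL_m`
(Jacquet–Piatetski-Shapiro–Shalika (1983), §2, (2.7); Cogdell (2004), §4.1, `Ψ = ∏_v Ψ_v`), `ι = glCorner`:

* `valued_eq_one_of_corner_ne_zero` (= `stub_corner_unitBox_support`) — **the corner support theorem at one
  place**: for `W` on `GL_{m+1}(𝔸_K)` left `ψ`-equivariant, central up to modulus one and spread at `v` (NO depth
  hypothesis), `W(G ι(diag(a) k)) ≠ 0` at a base point `G` with trivial `v`-component forces `|a_{i,v}| = 1`: the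
  `v`-component of `ι(diag(a) k)` is `diag(a_v, 1) · diag(k_v, 1)` with `diag(k_v, 1) ∈ GL_{m+1}(𝒪_v)` of last row
  EXACTLY `e_{m+1}`, so the torus form of the support theorem (`WhittakerSupport.valuation_eq_of_glDiagonal_mul_ne_zero`,
  at a depth below the level, `exists_nat_exp_neg_mul_le`) gives `|a_{i,v}| = |1|_v`;
* `glCorner_mem_principalCongruenceLevel`, `apply_mul_glCorner_ofFinite` — `ι(K_m(𝔫)) ≤ K_{m+1}(𝔫)`, so `W ∘ ι` is
  right `K_f(𝔫)`-invariant when `W` is; `glCorner_ofInfinite` — `ι((h, 1)) = ((diag(h, 1)), 1)`;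
  `localComponent_glDiagonal_snoc` — `diag(τ, 1)_v = 1` when `(diag τ)_v = 1`;
* `corner_pair_eq_prod_mul_pair` — **peeling the places of `S ⊆ T` off `W(ι g) W̄'(g)`**: the corner version of
  `UnitBoxTranslateProductForm.pair_eq_prod_mul_pair` (induction on `S`, no last-row hypothesis).

All proofs complete; tree theorems only.

## References

* H. Jacquet, I. I. Piatetski-Shapiro, J. A. Shalika, *Rankin–Selberg convolutions*, Amer. J. Math.
  105 (1983), §2, (2.7) [JacquetPiatetskiShapiroShalika1983].
* J. W. Cogdell, *Analytic theory of L-functions for GL_n*, in *An Introduction to the Langlands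
  Program* (2004), §2.3, §4.1 [CogdellAnalyticTheory2004].
-/

noncomputable section

-- `Summit.Langlands.Langlands.…` (summit = sub-problem name, D-0017 layout) trips `dupNamespace`
set_option linter.dupNamespace false

open scoped MatrixGroups Topology Pointwise ENNReal NNReal ComplexConjugate InnerProductSpace ContDiff
-- the place subtypes indexing `mixedSpace K` are `Fintype` classically (`NormedCommRing (mixedSpace K)`)
open scoped Classical Matrix.Norms.Operator
open NumberField IsDedekindDomain MeasureTheory Measure Matrix Set Filter WithZero
open NumberField.mixedEmbedding
open Literature.NumberTheory.Automorphic AdelicGroupData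
open Literature.NumberTheory.GaloisRepresentations (ideleGroup HeckeCharacter)
open ValuativeRel

-- no local instances needed in this file (pointwise statements only)

namespace Summit.Langlands.Langlands.Theorems.CornerUnitBoxProductForm

/-! ### A depth below the level -/

section Depth

/-- **A depth below any level**: for `b ≠ 0` in `ℤᵐ⁰` there is `N ∈ ℕ` with `exp(-N) a ≤ exp(-M) b`. [folklore] -/
theorem exists_nat_exp_neg_mul_le {a b : ℤᵐ⁰} (hb : b ≠ 0) (M : ℤ) : ∃ N : ℕ, exp (-(N : ℤ)) * a ≤ exp (-M) * b := by
  by_cases ha : a = 0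
  · exact ⟨0, by rw [ha, mul_zero]; exact zero_le⟩
  obtain ⟨α, rfl⟩ : ∃ α : ℤ, a = exp α := ⟨a.log, (exp_log ha).symm⟩
  obtain ⟨β, rfl⟩ : ∃ β : ℤ, b = exp β := ⟨b.log, (exp_log hb).symm⟩
  refine ⟨(M + α - β).toNat, ?_⟩
  rw [← exp_add, ← exp_add, exp_le_exp]
  have := Int.self_le_toNat (M + α - β)
  omega

end Depth

/-! ### The corner support theorem at one bad place -/

section Support

variable {m : ℕ} {K : Type} [Field K] [NumberField K] {v : HeightOneSpectrum (𝓞 K)}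
  {ψ : AddChar (AdeleRing (𝓞 K) K) Circle} {W : GL (Fin (m + 1)) (AdeleRing (𝓞 K) K) → ℂ}
  {t : Fin (m + 1) → (v.adicCompletion K)ˣ} {M c₀ : ℤ}

/-- **The corner support theorem at one place.** Let `W : GL_{m+1}(𝔸_K) → ℂ` be left `ψ`-equivariant, with
`‖W(z g)‖ = ‖W(g)‖` for scalar ideles `z`, and spread at `v` (`IsSpreadWhittakerAt v ψ t M W`, `ψ_v` non-trivial on
`{|y| ≤ exp(1 - c₀)}`, `M ≥ 1`, monotone `|t_i|` with gaps — NO depth hypothesis). If `W(G · diag(diag(a) k, 1)) ≠ 0`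
for a base point `G` with trivial `v`-component, `a ∈ (𝔸_Kˣ)ᵐ` and `k` in the maximal compact subgroup, then every
`a_i` is a unit at `v`: the `v`-component of `diag(diag(a) k, 1)` is `diag(a_v, 1) · diag(k_v, 1)` with
`diag(k_v, 1) ∈ GL_{m+1}(𝒪_v)` of last row EXACTLY `e_{m+1}`, so the torus form of the support theorem
(`WhittakerSupport.valuation_eq_of_glDiagonal_mul_ne_zero`, at any depth below the level) gives
`|a_{i,v}| = |1|_v = 1`. [folklore] -/
theorem valued_eq_one_of_corner_ne_zero
    (hWN : ∀ (u : ↥(adelicUnipotent (m + 1) K)) (g : GL (Fin (m + 1)) (AdeleRing (𝓞 K) K)),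
      W ((u : GL (Fin (m + 1)) (AdeleRing (𝓞 K) K)) * g) = whittakerCharFun ψ u * W g)
    (hWZ : ∀ (z : ideleGroup K) (g : GL (Fin (m + 1)) (AdeleRing (𝓞 K) K)),
      ‖W (Matrix.GeneralLinearGroup.scalar (Fin (m + 1)) z * g)‖ = ‖W g‖)
    (hW : IsSpreadWhittakerAt v ψ t M W)
    (hψv : ∃ y : v.adicCompletion K, Valued.v y ≤ exp (1 - c₀) ∧ ψ.adicComponent v y ≠ 1) (hM₁ : 1 ≤ M)
    (hmono : ∀ i j : Fin (m + 1), i ≤ j → Valued.v (t j : v.adicCompletion K) ≤ Valued.v (t i : v.adicCompletion K))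
    (hgap : ∀ i j : Fin (m + 1), (i : ℕ) + 1 = j →
      exp (M - c₀) * Valued.v (t j : v.adicCompletion K) ≤ Valued.v (t i : v.adicCompletion K))
    {G : GL (Fin (m + 1)) (AdeleRing (𝓞 K) K)} (hG : localComponent v G = 1)
    (a : Fin m → ideleGroup K) (k : ↥(maximalCompactAdelic m K))
    (hne : W (G * glCorner (AdeleRing (𝓞 K) K) (Nat.le_succ m) (torusPoint m K (a, k))) ≠ 0) (i : Fin m) :
    Valued.v (((a i : ideleGroup K) : AdeleRing (𝓞 K) K).2 v) = 1 := by
  -- a depth below the level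
  obtain ⟨N, hN⟩ := exists_nat_exp_neg_mul_le (a := Valued.v (t 0 : v.adicCompletion K))
    ((Valuation.ne_zero_iff _).2 (t (Fin.last m)).ne_zero) M
  -- the `v`-component of the corner torus point: `diag(a_v, 1) · diag(k_v, 1)`
  set kv : GL (Fin m) (v.adicCompletion K) :=
    localComponent v (show GL (Fin m) (AdeleRing (𝓞 K) K) from (k : (AdelicGroupData.gl m K).Adelic)) with hkv
  set av : Fin (m + 1) → (v.adicCompletion K)ˣ := fun i =>
    Units.map (AdelicGroupData.adeleEval K v : AdeleRing (𝓞 K) K →+* v.adicCompletion K).toMonoidHom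
      ((Fin.snoc a 1 : Fin (m + 1) → ideleGroup K) i) with hav
  set tp : GL (Fin (m + 1)) (AdeleRing (𝓞 K) K) := glCorner (AdeleRing (𝓞 K) K) (Nat.le_succ m) (torusPoint m K (a, k))
    with htp
  have htpv : localComponent v tp =
      glDiagonal (m + 1) (v.adicCompletion K) av * glCorner (v.adicCompletion K) (Nat.le_succ m) kv := by
    rw [htp, CornerPairTranslate.glCorner_torusPoint, UnitBoxTranslateProductForm.localComponent_mul,
      CornerPairTranslate.localComponent_glCorner]
    congr 1
    exact generalLinearGroup_map_glDiagonal _ _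
  set g : GL (Fin (m + 1)) (AdeleRing (𝓞 K) K) := G * tp with hg
  have hgv : localComponent v g = localComponent v tp := by
    rw [hg, UnitBoxTranslateProductForm.localComponent_mul, hG, one_mul]
  set g' : GL (Fin (m + 1)) (AdeleRing (𝓞 K) K) := g * GLn.ofLocal (m + 1) K v (localComponent v g)⁻¹ with hg'
  have hg'1 : localComponent v g' = 1 := localComponent_mul_ofLocal_inv g
  have hWloc : WhittakerSupport.IsSpreadWhittaker (ψ.adicComponent v) t M
      (fun h => W (g' * GLn.ofLocal (m + 1) K v h)) := isSpreadWhittaker_ofLocal hWN hW hg'1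
  have hcent : ∀ (z : (v.adicCompletion K)ˣ) (h : GL (Fin (m + 1)) (v.adicCompletion K)),
      W (g' * GLn.ofLocal (m + 1) K v h) ≠ 0 →
        W (g' * GLn.ofLocal (m + 1) K v (glDiagonal (m + 1) (v.adicCompletion K) (fun _ => z) * h)) ≠ 0 :=
    fun z h hz => ofLocal_scalar_ne_zero hWZ g' z h hz
  have hne' : W (g' * GLn.ofLocal (m + 1) K v
      (glDiagonal (m + 1) (v.adicCompletion K) av * glCorner (v.adicCompletion K) (Nat.le_succ m) kv)) ≠ 0 := by
    rw [← htpv, ← hgv, hg', mul_assoc, ← map_mul, inv_mul_cancel, map_one, mul_one]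
    exact hne
  have hkv1 : glCorner (v.adicCompletion K) (Nat.le_succ m) kv ∈ valuedCongruenceSubgroup (Fin (m + 1)) (1 : ℤᵐ⁰) := by
    rw [glCorner_mem_valuedCongruenceSubgroup_iff, ← glInt_adicCompletion_eq]
    exact localComponent_mem_glInt_of_mem_maximalCompactAdelic k.2
  have hlast : ∀ j : Fin (m + 1), j ≠ Fin.last m →
      Valued.v (((glCorner (v.adicCompletion K) (Nat.le_succ m) kv : GL (Fin (m + 1)) (v.adicCompletion K)) :
        Matrix (Fin (m + 1)) (Fin (m + 1)) (v.adicCompletion K)) (Fin.last m) j) ≤ exp (-(N : ℤ)) := fun j hj => by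
    rw [glCorner_last_apply, if_neg hj, Valuation.map_zero]
    exact zero_le
  have h := WhittakerSupport.valuation_eq_of_glDiagonal_mul_ne_zero (ψ.adicComponent v) hψv hM₁ hmono hgap hWloc
    hcent hN av hkv1 hlast hne' (Fin.castSucc i)
  have hav_i : ((av (Fin.castSucc i) : (v.adicCompletion K)ˣ) : v.adicCompletion K) =
      ((a i : ideleGroup K) : AdeleRing (𝓞 K) K).2 v := by
    simp only [hav, Fin.snoc_castSucc]
    rfl
  have hav_last : av (Fin.last m) = 1 := by simp only [hav, Fin.snoc_last, map_one]
  rw [hav_last, Units.val_one, Valuation.map_one, hav_i] at h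
  exact h

end Support

/-! ### The corner against the levels and the archimedean embedding -/

section Glue

variable {m : ℕ} {K : Type} [Field K] [NumberField K]

/-- **`ι(K_m(𝔫)) ≤ K_{m+1}(𝔫)`**: `K(𝔫)` is defined place by place (`mem_principalCongruenceLevel_iff_forall_toLocal`)
and `diag(·, 1)` preserves the local congruence subgroups (`glCorner_mem_valuedCongruenceSubgroup_iff`). [folklore] -/
theorem glCorner_mem_principalCongruenceLevel {𝔫 : Ideal (𝓞 K)} {g : GL (Fin m) (AdeleRing (𝓞 K) K)}
    (hg : g ∈ principalCongruenceLevel m K 𝔫) :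
    glCorner (AdeleRing (𝓞 K) K) (Nat.le_succ m) g ∈ principalCongruenceLevel (m + 1) K 𝔫 := by
  rw [mem_principalCongruenceLevel_iff_forall_toLocal] at hg ⊢
  refine ⟨by rw [GLn.fstHom_glCorner, hg.1, map_one], fun w => ?_⟩
  change localComponent w (glCorner (AdeleRing (𝓞 K) K) (Nat.le_succ m) g) ∈ _
  rw [CornerPairTranslate.localComponent_glCorner]
  exact (glCorner_mem_valuedCongruenceSubgroup_iff _).2 (hg.2 w)

/-- **`W ∘ ι` is right `K_f(𝔫)`-invariant when `W` is**: `W(G ι((1, u))) = W(G)` for `u ∈ K_{m,f}(𝔫)`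
(`ι((1, u)) = (1, u') ∈ K_{m+1}(𝔫)`, `GLn.ofFinite_sndHom_of_mem`). [folklore] -/
theorem apply_mul_glCorner_ofFinite {W : GL (Fin (m + 1)) (AdeleRing (𝓞 K) K) → ℂ} {𝔫 : Ideal (𝓞 K)}
    (hWK : ∀ u ∈ finitePrincipalCongruenceLevel (m + 1) K 𝔫, ∀ g : GL (Fin (m + 1)) (AdeleRing (𝓞 K) K),
      W (g * GLn.ofFinite (m + 1) K u) = W g)
    {u : GL (Fin m) (FiniteAdeleRing (𝓞 K) K)} (hu : u ∈ finitePrincipalCongruenceLevel m K 𝔫)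
    (G : GL (Fin (m + 1)) (AdeleRing (𝓞 K) K)) :
    W (G * glCorner (AdeleRing (𝓞 K) K) (Nat.le_succ m) (GLn.ofFinite m K u)) = W G := by
  have hU : glCorner (AdeleRing (𝓞 K) K) (Nat.le_succ m) (GLn.ofFinite m K u) ∈ principalCongruenceLevel (m + 1) K 𝔫 :=
    glCorner_mem_principalCongruenceLevel (mem_finitePrincipalCongruenceLevel_iff.1 hu)
  have hof : GLn.ofFinite (m + 1) K (GLn.sndHom (m + 1) K (glCorner (AdeleRing (𝓞 K) K) (Nat.le_succ m) (GLn.ofFinite m K u))) =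
      glCorner (AdeleRing (𝓞 K) K) (Nat.le_succ m) (GLn.ofFinite m K u) :=
    GLn.ofFinite_sndHom_of_mem (principalCongruenceLevel_le (m + 1) K 𝔫 hU)
  have hfin : GLn.sndHom (m + 1) K (glCorner (AdeleRing (𝓞 K) K) (Nat.le_succ m) (GLn.ofFinite m K u)) ∈
      finitePrincipalCongruenceLevel (m + 1) K 𝔫 := by
    rw [mem_finitePrincipalCongruenceLevel_iff, hof]
    exact hU
  rw [← hof]
  exact hWK _ hfin G

/-- **`ι` commutes with the archimedean embedding**: `diag((h, 1), 1) = ((diag(h, 1)), 1)` (compare the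
archimedean and finite parts, `GLn.ext_of_fstHom_of_sndHom`). [folklore] -/
theorem glCorner_ofInfinite (h : GL (Fin m) (mixedSpace K)) :
    glCorner (AdeleRing (𝓞 K) K) (Nat.le_succ m) (GLn.ofInfinite m K h) =
      GLn.ofInfinite (m + 1) K (glCorner (mixedSpace K) (Nat.le_succ m) h) := by
  refine GLn.ext_of_fstHom_of_sndHom ?_ ?_
  · rw [GLn.fstHom_glCorner, GLn.fstHom_ofInfinite, GLn.fstHom_ofInfinite, MulEquiv.eq_symm_apply,
      GLn.infiniteEquivMixed_eq_map, glCorner_map, ← GLn.infiniteEquivMixed_eq_map, MulEquiv.apply_symm_apply]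
  · rw [GLn.sndHom_glCorner, GLn.sndHom_ofInfinite, GLn.sndHom_ofInfinite, map_one]

/-- `diag(τ, 1)` has trivial `v`-component when `diag τ` has. [folklore] -/
theorem localComponent_glDiagonal_snoc {v : HeightOneSpectrum (𝓞 K)} {τ : Fin m → ideleGroup K}
    (hτ : localComponent v (glDiagonal m (AdeleRing (𝓞 K) K) τ) = 1) :
    localComponent v (glDiagonal (m + 1) (AdeleRing (𝓞 K) K) (Fin.snoc τ 1)) = 1 := by
  rw [← glCorner_glDiagonal_eq_glDiagonal_snoc, CornerPairTranslate.localComponent_glCorner, hτ, map_one]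

end Glue

/-! ### Peeling the bad places off the corner pair -/

section Peel

variable {m : ℕ} {K : Type} [Field K] [NumberField K]

/-- **Peeling the places of `S ⊆ T` off the corner pair `W(ι g) W̄'(g)`.** Let `W` on `GL_{m+1}(𝔸_K)` and `W'` on
`GL_m(𝔸_K)` be right `K_f(𝔫)`-invariant with the primes of `𝔫` in `T`, and suppose that at every `v ∈ T` the value
`W(ι(g' ι_v(x))) W̄'(g' ι_v(x))` at a base point `g' ∈ GL_m(𝔸_K)` with trivial `v`-component and ANY `x ∈ GL_m(K_v)` is
`J_v(x) W(ι g') W̄'(g')`. Then for `g`, `g'` with the same archimedean part, `g'` trivial at `S`, `g = g'` at the places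
of `T` off `S` and `g'_w⁻¹ g_w ∈ GL_m(𝒪_w)` off `T`: `W(ι g) W̄'(g) = (∏_{v ∈ S} J_v(g_v)) W(ι g') W̄'(g')` (induction on
`S`; the base case is right `K_f(𝔫)`-invariance, `apply_mul_glCorner_ofFinite`). [folklore] -/
theorem corner_pair_eq_prod_mul_pair {W : GL (Fin (m + 1)) (AdeleRing (𝓞 K) K) → ℂ} {W' : GL (Fin m) (AdeleRing (𝓞 K) K) → ℂ}
    {𝔫 : Ideal (𝓞 K)} (h𝔫 : 𝔫 ≠ 0)
    (hWK : ∀ u ∈ finitePrincipalCongruenceLevel (m + 1) K 𝔫, ∀ g : GL (Fin (m + 1)) (AdeleRing (𝓞 K) K),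
      W (g * GLn.ofFinite (m + 1) K u) = W g)
    (hW'K : ∀ u ∈ finitePrincipalCongruenceLevel m K 𝔫, ∀ g : GL (Fin m) (AdeleRing (𝓞 K) K),
      W' (g * GLn.ofFinite m K u) = W' g)
    {T : Finset (HeightOneSpectrum (𝓞 K))} (hT : ∀ w : HeightOneSpectrum (𝓞 K), w.asIdeal ∣ 𝔫 → w ∈ T)
    (J : (v : HeightOneSpectrum (𝓞 K)) → GL (Fin m) (v.adicCompletion K) → ℂ)
    (hJ : ∀ v ∈ T, ∀ g' : GL (Fin m) (AdeleRing (𝓞 K) K), localComponent v g' = 1 →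
      ∀ x : GL (Fin m) (v.adicCompletion K),
        W (glCorner (AdeleRing (𝓞 K) K) (Nat.le_succ m) (g' * GLn.ofLocal m K v x)) * star (W' (g' * GLn.ofLocal m K v x)) =
          J v x * (W (glCorner (AdeleRing (𝓞 K) K) (Nat.le_succ m) g') * star (W' g'))) :
    ∀ S : Finset (HeightOneSpectrum (𝓞 K)), S ⊆ T → ∀ g g' : GL (Fin m) (AdeleRing (𝓞 K) K),
      (∀ v ∈ S, localComponent v g' = 1) →
      (∀ w, w ∉ S → w ∈ T → localComponent w g = localComponent w g') →
      (∀ w, w ∉ T → (localComponent w g')⁻¹ * localComponent w g ∈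
        valuedCongruenceSubgroup (Fin m) (1 : ℤᵐ⁰)) →
      GLn.fstHom m K g = GLn.fstHom m K g' →
      W (glCorner (AdeleRing (𝓞 K) K) (Nat.le_succ m) g) * star (W' g) =
        (∏ v ∈ S, J v (localComponent v g)) * (W (glCorner (AdeleRing (𝓞 K) K) (Nat.le_succ m) g') * star (W' g')) := by
  intro S
  induction S using Finset.induction_on with
  | empty =>
    intro _ g g' _ h2 h3 h4
    rw [Finset.prod_empty, one_mul]
    -- `g'⁻¹ g ∈ K(𝔫)`, place by place
    have hu₀ : g'⁻¹ * g ∈ principalCongruenceLevel m K 𝔫 := by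
      rw [mem_principalCongruenceLevel_iff_forall_toLocal]
      refine ⟨by rw [map_mul, map_inv, h4, inv_mul_cancel], fun w => ?_⟩
      change localComponent w (g'⁻¹ * g) ∈ valuedCongruenceSubgroup (Fin m) (idealRadius K w 𝔫)
      rw [UnitBoxTranslateProductForm.localComponent_mul, UnitBoxTranslateProductForm.localComponent_inv]
      by_cases hwT : w ∈ T
      · rw [h2 w (Finset.notMem_empty w) hwT, inv_mul_cancel]
        exact one_mem _
      · rw [idealRadius_eq_one_of_not_dvd h𝔫 (fun h => hwT (hT w h))]
        exact h3 w hwT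
    have hint : g'⁻¹ * g ∈ glIntegralLevel m K := principalCongruenceLevel_le m K 𝔫 hu₀
    have hof : GLn.ofFinite m K (GLn.sndHom m K (g'⁻¹ * g)) = g'⁻¹ * g := GLn.ofFinite_sndHom_of_mem hint
    have hfin : GLn.sndHom m K (g'⁻¹ * g) ∈ finitePrincipalCongruenceLevel m K 𝔫 := by
      rw [mem_finitePrincipalCongruenceLevel_iff, hof]
      exact hu₀
    have hg : g = g' * GLn.ofFinite m K (GLn.sndHom m K (g'⁻¹ * g)) := by rw [hof, mul_inv_cancel_left]
    rw [hg, map_mul, apply_mul_glCorner_ofFinite hWK hfin, hW'K _ hfin]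
  | insert v S hvS ih =>
    intro hST g g' h1 h2 h3 h4
    have hvT : v ∈ T := hST (Finset.mem_insert_self v S)
    -- move the `v`-component of `g` onto the base point
    set g'' : GL (Fin m) (AdeleRing (𝓞 K) K) := g' * GLn.ofLocal m K v (localComponent v g) with hg''
    have hloc : ∀ w, localComponent w g'' =
        localComponent w g' * localComponent w (GLn.ofLocal m K v (localComponent v g)) := fun w => by
      rw [hg'', UnitBoxTranslateProductForm.localComponent_mul]
    have key := ih ((Finset.subset_insert v S).trans hST) g g'' ?_ ?_ ?_ ?_
    · rw [key, Finset.prod_insert hvS, hg'', hJ v hvT g' (h1 v (Finset.mem_insert_self v S)) (localComponent v g)]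
      ring
    · intro w hw
      have hwv : w ≠ v := fun h => hvS (h ▸ hw)
      rw [hloc, h1 w (Finset.mem_insert_of_mem hw), one_mul, UnitBoxTranslateProductForm.localComponent_ofLocal_of_ne hwv]
    · intro w hwS hwT
      by_cases hwv : w = v
      · subst hwv
        rw [hloc, h1 w (Finset.mem_insert_self w S), one_mul, UnitBoxTranslateProductForm.localComponent_ofLocal_self]
      · rw [hloc, UnitBoxTranslateProductForm.localComponent_ofLocal_of_ne hwv, mul_one]
        exact h2 w (fun h => (Finset.mem_insert.1 h).elim hwv hwS) hwT
    · intro w hwT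
      have hwv : w ≠ v := fun h => hwT (h ▸ hvT)
      rw [hloc, UnitBoxTranslateProductForm.localComponent_ofLocal_of_ne hwv, mul_one]
      exact h3 w hwT
    · rw [hg'', map_mul, GLn.fstHom_ofLocal, mul_one, h4]

end Peel

/-! ### The registered sub-goal: the corner support theorem at one place -/

section SubGoal

/-- **SUB-GOAL (W-CPF, part 2) — the corner support theorem at one bad place**, `∀`-form of
`valued_eq_one_of_corner_ne_zero`: for `W` on `GL_{m+1}(𝔸_K)` left `ψ`-equivariant, central up to modulus one and
spread at `v` (no depth hypothesis), a base point `G` with trivial `v`-component, `a ∈ (𝔸_Kˣ)ᵐ` and `k` in the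
maximal compact subgroup: `W(G · diag(diag(a) k, 1)) ≠ 0` forces `|a_{i,v}| = 1` for every `i`
(Jacquet–Piatetski-Shapiro–Shalika (1983), (2.7), corner case). [folklore] -/
theorem stub_corner_unitBox_support :
    ∀ {m : ℕ} {K : Type} [Field K] [NumberField K] {v : HeightOneSpectrum (𝓞 K)}
      {ψ : AddChar (AdeleRing (𝓞 K) K) Circle} {W : GL (Fin (m + 1)) (AdeleRing (𝓞 K) K) → ℂ}
      {t : Fin (m + 1) → (v.adicCompletion K)ˣ} {M c₀ : ℤ}
      (_ : ∀ (u : ↥(adelicUnipotent (m + 1) K)) (g : GL (Fin (m + 1)) (AdeleRing (𝓞 K) K)), W ((u : GL (Fin (m + 1)) (AdeleRing (𝓞 K) K)) * g) = whittakerCharFun ψ u * W g)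
      (_ : ∀ (z : ideleGroup K) (g : GL (Fin (m + 1)) (AdeleRing (𝓞 K) K)), ‖W (Matrix.GeneralLinearGroup.scalar (Fin (m + 1)) z * g)‖ = ‖W g‖)
      (_ : IsSpreadWhittakerAt v ψ t M W)
      (_ : ∃ y : v.adicCompletion K, Valued.v y ≤ exp (1 - c₀) ∧ ψ.adicComponent v y ≠ 1) (_ : 1 ≤ M)
      (_ : ∀ i j : Fin (m + 1), i ≤ j → Valued.v (t j : v.adicCompletion K) ≤ Valued.v (t i : v.adicCompletion K))
      (_ : ∀ i j : Fin (m + 1), (i : ℕ) + 1 = j → exp (M - c₀) * Valued.v (t j : v.adicCompletion K) ≤ Valued.v (t i : v.adicCompletion K))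
      {G : GL (Fin (m + 1)) (AdeleRing (𝓞 K) K)} (_ : localComponent v G = 1)
      (a : Fin m → ideleGroup K) (k : ↥(maximalCompactAdelic m K))
      (_ : W (G * glCorner (AdeleRing (𝓞 K) K) (Nat.le_succ m) (torusPoint m K (a, k))) ≠ 0) (i : Fin m),
    Valued.v (((a i : ideleGroup K) : AdeleRing (𝓞 K) K).2 v) = 1 := by
  intro m K _ _ v ψ W t M c₀ hWN hWZ hW hψv hM₁ hmono hgap G hG a k hne i
  exact valued_eq_one_of_corner_ne_zero hWN hWZ hW hψv hM₁ hmono hgap hG a k hne i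

end SubGoal

end Summit.Langlands.Langlands.Theorems.CornerUnitBoxProductForm
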